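import Mathlib
import Literature.Analysis.FluidPDE.VectorCalculus
import Summits.NavierStokesRegularity.NavierStokesRegularity.Theorems.FilamentSkeletonRssAnalyticStripLiaSymbolDefs
import Summits.NavierStokesRegularity.NavierStokesRegularity.Theorems.FilamentSkeletonRssClause13TaylorRemainderKernel

/-!
# Clause 13-J, brick B3: the SYMBOL LINK — plane waves are exact eigenfunctions of the straight matched-filament
# Taylor-remainder operator, with multiplier `(2/q)·𝔖(k√q)` (`liaSym`)

Route `FilamentSkeletonRss`, child 28296 `Clause13NearStraight` of `SkeletonJ1G` (stmt-27849); design memo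
`filament-plan/DESIGN-28296-clause13-g12.md` §4 B3.  Bricks B1/B2 (`…Clause13StraightSelfTerm.selfTerm_straight`,
`…Clause13TaylorRemainderKernel.taylorRemainderOp_eq`) reduce the self term of the linearised map on the straight
constant-core model to the Taylor-remainder operator `M_q[f](τ) = ∫ ((τ−σ)²+q)^{-3/2} (f τ − f σ − (τ−σ) f′σ) dσ`.
This file links `M_q` BY NAME to the exact static self-induction symbol `liaSym = 𝔖` of the line
`child_tangent_analytic_strip` (`…AnalyticStripLiaSymbolDefs.liaSym`, whose bounds `LiaSymbolBound` are landed):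

* `integral_liaFactor_mul_K3` : `∫ (1 − cos ks − ks·sin ks)(s²+q)^{-3/2} ds = (2/q)·𝔖(k√q)` (whole line; evenness + `s = √q·h`);
* `integral_oddFactor_mul_K3` : `∫ (sin ks − ks·cos ks)(s²+q)^{-3/2} ds = 0` (odd integrand);
* `taylorRemainderOp_cos` / `taylorRemainderOp_sin` : `M_q[cos k·] = (2/q)𝔖(k√q)·cos k·`, same for `sin`;
* `selfTerm_mode` : for the normal mode `Y σ = cos(kσ)•a + sin(kσ)•b` the B1 self term is
  `∫ ((τ−σ)²+q)^{-3/2} • t × (Y τ − Y σ − (τ−σ)•Y′σ) dσ = ((2/q)𝔖(k√q)) • t × Y τ`.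

So on the model the linearised normal self-induction acts on each Fourier mode as multiplication by
`(Γγ/4π)(2/μ²)𝔖(kμ)` (`q = μ²`), the multiplier whose sign structure (`𝔖 ≤ x²/12`, `𝔖 ≥ −x²/3` on `[½,∞)`, Klein–Majda
asymptotics) is the landed `stub_liaSymbol`.  Lane ns-filament-19175-p1 g13; `--supports stmt-NavierStokesRegularity-28296 --as helper`.
HONEST FRAMING: calculus for a HYPOTHETICAL filament skeleton on the NEGATIVE side of a MODEL route; nothing here bears on
Navier–Stokes regularity or blow-up.
-/

noncomputable section

open scoped InnerProductSpace
open MeasureTheory Set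
open Literature.Analysis.FluidPDE
open Summit.NavierStokesRegularity.NavierStokesRegularity.Theorems.AnalyticStripLiaSymbol (liaSym)

namespace Summit.NavierStokesRegularity.NavierStokesRegularity.Theorems.MatchedKernel
set_option linter.dupNamespace false

/-! ### Pointwise bounds and integrability of the two oscillatory kernels -/

/-- `|1 − cos u − u sin u| ≤ 2 + |u|`. [folklore] -/
theorem abs_liaFactor_le (u : ℝ) : |1 - Real.cos u - u * Real.sin u| ≤ 2 + |u| := by
  have h1 : |1 - Real.cos u| ≤ 2 := by
    have := Real.abs_cos_le_one u
    rw [abs_le] at this ⊢; constructor <;> linarith [this.1, this.2]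
  have h2 : |u * Real.sin u| ≤ |u| := by
    rw [abs_mul]
    calc |u| * |Real.sin u| ≤ |u| * 1 := by gcongr; exact Real.abs_sin_le_one _
      _ = |u| := mul_one _
  calc |1 - Real.cos u - u * Real.sin u| ≤ |1 - Real.cos u| + |u * Real.sin u| := abs_sub _ _
    _ ≤ 2 + |u| := add_le_add h1 h2

/-- `|sin u − u cos u| ≤ 1 + |u|`. [folklore] -/
theorem abs_oddFactor_le (u : ℝ) : |Real.sin u - u * Real.cos u| ≤ 1 + |u| := by
  have h2 : |u * Real.cos u| ≤ |u| := by
    rw [abs_mul]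
    calc |u| * |Real.cos u| ≤ |u| * 1 := by gcongr; exact Real.abs_cos_le_one _
      _ = |u| := mul_one _
  calc |Real.sin u - u * Real.cos u| ≤ |Real.sin u| + |u * Real.cos u| := abs_sub _ _
    _ ≤ 1 + |u| := add_le_add (Real.abs_sin_le_one _) h2

/-- Continuity of the kernel `s ↦ ((s²+q)^{3/2})⁻¹` for `q > 0`. [folklore] -/
theorem continuous_K3 {q : ℝ} (hq : 0 < q) : Continuous (fun s : ℝ => ((s ^ 2 + q) ^ (3 / 2 : ℝ))⁻¹) := by
  have hσ : ∀ s : ℝ, 0 < s ^ 2 + q := fun s => by positivity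
  exact (((continuous_pow 2).add continuous_const).rpow_const
    (fun s => Or.inl (hσ s).ne')).inv₀ (fun s => (Real.rpow_pos_of_pos (hσ s) _).ne')

/-- A factor bounded by `A + B|ks|` against the kernel `((s²+q)^{3/2})⁻¹` is dominated by a multiple of the Cauchy kernel
`(1+s²)⁻¹`. [folklore] -/
theorem factor_mul_K3_le {q : ℝ} (hq : 0 < q) {A B k s φ : ℝ} (hA : 0 ≤ A) (hB : 0 ≤ B) (hφ : |φ| ≤ A + B * |k * s|) :
    |φ * ((s ^ 2 + q) ^ (3 / 2 : ℝ))⁻¹|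
      ≤ (A * ((Real.sqrt q)⁻¹ * max 1 q⁻¹) + B * |k| * max 1 q⁻¹) * (1 + s ^ 2)⁻¹ := by
  have hK : 0 < ((s ^ 2 + q) ^ (3 / 2 : ℝ))⁻¹ := inv_pos.mpr (Real.rpow_pos_of_pos (by positivity) _)
  rw [abs_mul, abs_of_pos hK]
  have h1 := K3_le_inv_one_add_sq hq s
  have h2 := abs_mul_K3_le hq s
  calc |φ| * ((s ^ 2 + q) ^ (3 / 2 : ℝ))⁻¹ ≤ (A + B * |k * s|) * ((s ^ 2 + q) ^ (3 / 2 : ℝ))⁻¹ := by gcongr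
    _ = A * ((s ^ 2 + q) ^ (3 / 2 : ℝ))⁻¹ + B * |k| * (|s| * ((s ^ 2 + q) ^ (3 / 2 : ℝ))⁻¹) := by
        rw [abs_mul]; ring
    _ ≤ A * ((Real.sqrt q)⁻¹ * max 1 q⁻¹ * (1 + s ^ 2)⁻¹) + B * |k| * (max 1 q⁻¹ * (1 + s ^ 2)⁻¹) := by
        gcongr
    _ = _ := by ring

/-- Integrability of `(1 − cos ks − ks sin ks)(s²+q)^{-3/2}` on the line (`q > 0`). [folklore] -/
theorem integrable_liaFactor_mul_K3 {q : ℝ} (hq : 0 < q) (k : ℝ) :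
    Integrable (fun s : ℝ => (1 - Real.cos (k * s) - k * s * Real.sin (k * s)) * ((s ^ 2 + q) ^ (3 / 2 : ℝ))⁻¹) := by
  refine Integrable.mono' (integrable_inv_one_add_sq.const_mul
      (2 * ((Real.sqrt q)⁻¹ * max 1 q⁻¹) + 1 * |k| * max 1 q⁻¹)) ?_ (Filter.Eventually.of_forall fun s => ?_)
  · exact (Continuous.mul (by fun_prop) (continuous_K3 hq)).aestronglyMeasurable
  · rw [Real.norm_eq_abs]
    refine factor_mul_K3_le hq (by norm_num) (by norm_num) ?_
    simpa [one_mul] using abs_liaFactor_le (k * s)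

/-- Integrability of `(sin ks − ks cos ks)(s²+q)^{-3/2}` on the line (`q > 0`). [folklore] -/
theorem integrable_oddFactor_mul_K3 {q : ℝ} (hq : 0 < q) (k : ℝ) :
    Integrable (fun s : ℝ => (Real.sin (k * s) - k * s * Real.cos (k * s)) * ((s ^ 2 + q) ^ (3 / 2 : ℝ))⁻¹) := by
  refine Integrable.mono' (integrable_inv_one_add_sq.const_mul
      (1 * ((Real.sqrt q)⁻¹ * max 1 q⁻¹) + 1 * |k| * max 1 q⁻¹)) ?_ (Filter.Eventually.of_forall fun s => ?_)
  · exact (Continuous.mul (by fun_prop) (continuous_K3 hq)).aestronglyMeasurable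
  · rw [Real.norm_eq_abs]
    refine factor_mul_K3_le hq (by norm_num) (by norm_num) ?_
    simpa [one_mul] using abs_oddFactor_le (k * s)

/-! ### The two whole-line integrals -/

/-- **B3, the symbol link.** `∫ (1 − cos ks − ks sin ks)(s²+q)^{-3/2} ds = (2/q)·𝔖(k√q)` for `q > 0`: the integrand is even,
and on `(0,∞)` the substitution `s = √q·h` turns it into `q^{-3/2}` times the defining integrand of `liaSym (k√q)`. [folklore] -/
theorem integral_liaFactor_mul_K3 {q : ℝ} (hq : 0 < q) (k : ℝ) :
    ∫ s : ℝ, (1 - Real.cos (k * s) - k * s * Real.sin (k * s)) * ((s ^ 2 + q) ^ (3 / 2 : ℝ))⁻¹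
      = 2 / q * liaSym (k * √q) := by
  set g : ℝ → ℝ := fun s => (1 - Real.cos (k * s) - k * s * Real.sin (k * s)) * ((s ^ 2 + q) ^ (3 / 2 : ℝ))⁻¹
    with hg
  -- evenness
  have heven : ∀ s : ℝ, g |s| = g s := by
    intro s
    rcases le_or_gt 0 s with hs | hs
    · rw [abs_of_nonneg hs]
    · simp only [hg, abs_of_neg hs, mul_neg, Real.cos_neg, Real.sin_neg, neg_mul, neg_neg, neg_sq]
  have h1 : ∫ s, g s = ∫ s, g |s| := by
    congr 1; funext s; exact (heven s).symm
  rw [h1, integral_comp_abs]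
  -- substitution `s = √q · h` on `(0, ∞)`
  have hsq : 0 < √q := Real.sqrt_pos.mpr hq
  have hsub := integral_comp_mul_left_Ioi g 0 hsq
  rw [mul_zero, smul_eq_mul] at hsub
  have hI : ∫ s in Ioi (0:ℝ), g s = √q * ∫ h in Ioi (0:ℝ), g (√q * h) := by
    rw [hsub, ← mul_assoc, mul_inv_cancel₀ hsq.ne', one_mul]
  rw [hI]
  -- pointwise: `g (√q h) = (q^{3/2})⁻¹ · (defining integrand of liaSym (k√q) at h)`
  have hpt : ∀ h ∈ Ioi (0:ℝ), g (√q * h)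
      = (q ^ (3 / 2 : ℝ))⁻¹ * ((1 - Real.cos (k * √q * h) - k * √q * h * Real.sin (k * √q * h))
          * ((1 + h ^ 2) ^ (3 / 2 : ℝ))⁻¹) := by
    intro h _
    have e1 : (√q * h) ^ 2 + q = q * (1 + h ^ 2) := by rw [mul_pow, Real.sq_sqrt hq.le]; ring
    have e2 : k * (√q * h) = k * √q * h := by ring
    simp only [hg]
    rw [e1, e2, Real.mul_rpow hq.le (by positivity), mul_inv]
    ring
  rw [setIntegral_congr_fun measurableSet_Ioi hpt, integral_const_mul]
  have h32 : q ^ (3 / 2 : ℝ) = q * √q := by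
    rw [show (3 / 2 : ℝ) = 1 + 1 / 2 by norm_num, Real.rpow_add hq, Real.rpow_one, Real.sqrt_eq_rpow]
  rw [h32, liaSym]
  field_simp

/-- `∫ (sin ks − ks cos ks)(s²+q)^{-3/2} ds = 0`: the integrand is odd (no integrability needed). [folklore] -/
theorem integral_oddFactor_mul_K3 (q k : ℝ) :
    ∫ s : ℝ, (Real.sin (k * s) - k * s * Real.cos (k * s)) * ((s ^ 2 + q) ^ (3 / 2 : ℝ))⁻¹ = 0 := by
  set g : ℝ → ℝ := fun s => (Real.sin (k * s) - k * s * Real.cos (k * s)) * ((s ^ 2 + q) ^ (3 / 2 : ℝ))⁻¹ with hg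
  have hodd : ∀ s, g (-s) = -g s := by
    intro s
    simp only [hg, mul_neg, Real.sin_neg, Real.cos_neg, neg_mul, neg_sq]
    ring
  have h1 : ∫ s, g (-s) = ∫ s, g s := integral_neg_eq_self g volume
  have h2 : ∫ s, g (-s) = -∫ s, g s := by
    simp_rw [hodd]; exact integral_neg g
  linarith

/-! ### Plane waves are eigenfunctions of the Taylor-remainder operator -/

/-- `d/dx cos(kx) = −k sin(kx)`. [folklore] -/
theorem deriv_cos_mul (k x : ℝ) : deriv (fun x : ℝ => Real.cos (k * x)) x = -k * Real.sin (k * x) := by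
  have h : HasDerivAt (fun x : ℝ => k * x) k x := by simpa using (hasDerivAt_id x).const_mul k
  rw [h.cos.deriv]; ring

/-- `d/dx sin(kx) = k cos(kx)`. [folklore] -/
theorem deriv_sin_mul (k x : ℝ) : deriv (fun x : ℝ => Real.sin (k * x)) x = k * Real.cos (k * x) := by
  have h : HasDerivAt (fun x : ℝ => k * x) k x := by simpa using (hasDerivAt_id x).const_mul k
  rw [h.sin.deriv]; ring

/-- The Taylor remainder of `cos k·` in the convolution variable `s = τ − σ`:
`cos kτ − cos kσ + (τ−σ)k sin kσ = cos kτ·(1 − cos ks − ks sin ks) − sin kτ·(sin ks − ks cos ks)`. [folklore] -/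
theorem cos_taylorRemainder (k τ σ : ℝ) :
    Real.cos (k * τ) - Real.cos (k * σ) - (τ - σ) * (-k * Real.sin (k * σ))
      = Real.cos (k * τ) * (1 - Real.cos (k * (τ - σ)) - k * (τ - σ) * Real.sin (k * (τ - σ)))
        - Real.sin (k * τ) * (Real.sin (k * (τ - σ)) - k * (τ - σ) * Real.cos (k * (τ - σ))) := by
  rw [show k * σ = k * τ - k * (τ - σ) by ring, Real.cos_sub, Real.sin_sub]
  ring

/-- The Taylor remainder of `sin k·` in the convolution variable `s = τ − σ`:
`sin kτ − sin kσ − (τ−σ)k cos kσ = sin kτ·(1 − cos ks − ks sin ks) + cos kτ·(sin ks − ks cos ks)`. [folklore] -/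
theorem sin_taylorRemainder (k τ σ : ℝ) :
    Real.sin (k * τ) - Real.sin (k * σ) - (τ - σ) * (k * Real.cos (k * σ))
      = Real.sin (k * τ) * (1 - Real.cos (k * (τ - σ)) - k * (τ - σ) * Real.sin (k * (τ - σ)))
        + Real.cos (k * τ) * (Real.sin (k * (τ - σ)) - k * (τ - σ) * Real.cos (k * (τ - σ))) := by
  rw [show k * σ = k * τ - k * (τ - σ) by ring, Real.cos_sub, Real.sin_sub]
  ring

/-- The even/odd combination integrates to the even part only: `∫ K₃(s)(A·φ(ks) + B·ψ(ks)) ds = A·(2/q)𝔖(k√q)` with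
`φ(u) = 1 − cos u − u sin u`, `ψ(u) = sin u − u cos u`, `K₃(s) = (s²+q)^{-3/2}`. [folklore] -/
theorem integral_combination {q : ℝ} (hq : 0 < q) (k A B : ℝ) :
    ∫ s : ℝ, ((s ^ 2 + q) ^ (3 / 2 : ℝ))⁻¹ *
        (A * (1 - Real.cos (k * s) - k * s * Real.sin (k * s)) + B * (Real.sin (k * s) - k * s * Real.cos (k * s)))
      = A * (2 / q * liaSym (k * √q)) := by
  have hsplit : (fun s : ℝ => ((s ^ 2 + q) ^ (3 / 2 : ℝ))⁻¹ *
        (A * (1 - Real.cos (k * s) - k * s * Real.sin (k * s)) + B * (Real.sin (k * s) - k * s * Real.cos (k * s))))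
      = fun s => A * ((1 - Real.cos (k * s) - k * s * Real.sin (k * s)) * ((s ^ 2 + q) ^ (3 / 2 : ℝ))⁻¹)
          + B * ((Real.sin (k * s) - k * s * Real.cos (k * s)) * ((s ^ 2 + q) ^ (3 / 2 : ℝ))⁻¹) := by
    funext s; ring
  rw [hsplit, integral_add ((integrable_liaFactor_mul_K3 hq k).const_mul A)
      ((integrable_oddFactor_mul_K3 hq k).const_mul B), integral_const_mul, integral_const_mul,
    integral_liaFactor_mul_K3 hq, integral_oddFactor_mul_K3, mul_zero, add_zero]

/-- The convolution form: `∫ K₃(τ−σ)(A·φ(k(τ−σ)) + B·ψ(k(τ−σ))) dσ = A·(2/q)𝔖(k√q)` (shift `σ ↦ τ − σ`). [folklore] -/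
theorem integral_shift_combination {q : ℝ} (hq : 0 < q) (k τ A B : ℝ) :
    ∫ σ : ℝ, (((τ - σ) ^ 2 + q) ^ (3 / 2 : ℝ))⁻¹ *
        (A * (1 - Real.cos (k * (τ - σ)) - k * (τ - σ) * Real.sin (k * (τ - σ)))
          + B * (Real.sin (k * (τ - σ)) - k * (τ - σ) * Real.cos (k * (τ - σ))))
      = A * (2 / q * liaSym (k * √q)) := by
  have hshift := integral_sub_left_eq_self (fun s : ℝ => ((s ^ 2 + q) ^ (3 / 2 : ℝ))⁻¹ *
        (A * (1 - Real.cos (k * s) - k * s * Real.sin (k * s)) + B * (Real.sin (k * s) - k * s * Real.cos (k * s))))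
      volume τ
  rw [hshift, integral_combination hq]

/-- **Eigen-relation, cosine.** `M_q[cos k·](τ) = (2/q)·𝔖(k√q)·cos kτ` for the Taylor-remainder operator of B1/B2. [folklore] -/
theorem taylorRemainderOp_cos {q : ℝ} (hq : 0 < q) (k τ : ℝ) :
    ∫ σ : ℝ, (((τ - σ) ^ 2 + q) ^ (3 / 2 : ℝ))⁻¹ *
        (Real.cos (k * τ) - Real.cos (k * σ) - (τ - σ) * deriv (fun x : ℝ => Real.cos (k * x)) σ)
      = 2 / q * liaSym (k * √q) * Real.cos (k * τ) := by
  have hpt : (fun σ : ℝ => (((τ - σ) ^ 2 + q) ^ (3 / 2 : ℝ))⁻¹ *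
        (Real.cos (k * τ) - Real.cos (k * σ) - (τ - σ) * deriv (fun x : ℝ => Real.cos (k * x)) σ))
      = fun σ => (((τ - σ) ^ 2 + q) ^ (3 / 2 : ℝ))⁻¹ *
        (Real.cos (k * τ) * (1 - Real.cos (k * (τ - σ)) - k * (τ - σ) * Real.sin (k * (τ - σ)))
          + (-Real.sin (k * τ)) * (Real.sin (k * (τ - σ)) - k * (τ - σ) * Real.cos (k * (τ - σ)))) := by
    funext σ; rw [deriv_cos_mul, cos_taylorRemainder]; ring
  rw [hpt, integral_shift_combination hq]; ring

/-- **Eigen-relation, sine.** `M_q[sin k·](τ) = (2/q)·𝔖(k√q)·sin kτ`. [folklore] -/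
theorem taylorRemainderOp_sin {q : ℝ} (hq : 0 < q) (k τ : ℝ) :
    ∫ σ : ℝ, (((τ - σ) ^ 2 + q) ^ (3 / 2 : ℝ))⁻¹ *
        (Real.sin (k * τ) - Real.sin (k * σ) - (τ - σ) * deriv (fun x : ℝ => Real.sin (k * x)) σ)
      = 2 / q * liaSym (k * √q) * Real.sin (k * τ) := by
  have hpt : (fun σ : ℝ => (((τ - σ) ^ 2 + q) ^ (3 / 2 : ℝ))⁻¹ *
        (Real.sin (k * τ) - Real.sin (k * σ) - (τ - σ) * deriv (fun x : ℝ => Real.sin (k * x)) σ))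
      = fun σ => (((τ - σ) ^ 2 + q) ^ (3 / 2 : ℝ))⁻¹ *
        (Real.sin (k * τ) * (1 - Real.cos (k * (τ - σ)) - k * (τ - σ) * Real.sin (k * (τ - σ)))
          + Real.cos (k * τ) * (Real.sin (k * (τ - σ)) - k * (τ - σ) * Real.cos (k * (τ - σ)))) := by
    funext σ; rw [deriv_sin_mul, sin_taylorRemainder]
  rw [hpt, integral_shift_combination hq]; ring

/-! ### The B1 self term on a normal Fourier mode -/

/-- Derivative of the mode `x ↦ cos(kx)•a + sin(kx)•b`. [folklore] -/
theorem deriv_mode (a b : EuclideanSpace ℝ (Fin 3)) (k σ : ℝ) :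
    deriv (fun x : ℝ => Real.cos (k * x) • a + Real.sin (k * x) • b) σ
      = (-Real.sin (k * σ) * k) • a + (Real.cos (k * σ) * k) • b := by
  have h : HasDerivAt (fun x : ℝ => k * x) k σ := by simpa using (hasDerivAt_id σ).const_mul k
  exact ((h.cos.smul_const a).add (h.sin.smul_const b)).deriv

/-- **B1 ∘ B3 — the model self term on a Fourier mode.**  For the mode `Y σ = cos(kσ)•a + sin(kσ)•b` (any fixed
`a b`; for a normal mode take `a, b ⊥ t`) the Taylor-remainder self term of `…Clause13StraightSelfTerm.selfTerm_straight` is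
`∫ ((τ−σ)²+q)^{-3/2} • t × (Y τ − Y σ − (τ−σ)•Y′σ) dσ = ((2/q)·𝔖(k√q)) • t × Y τ`: on the straight constant-core model the
linearised self-induction multiplies each mode by `(2/q)·liaSym(k√q)` (times `Γγ/4π`). [folklore] -/
theorem selfTerm_mode (t a b : EuclideanSpace ℝ (Fin 3)) {q : ℝ} (hq : 0 < q) (k τ : ℝ) :
    ∫ σ : ℝ, (((τ - σ) ^ 2 + q) ^ (3 / 2 : ℝ))⁻¹ •
        cross t ((Real.cos (k * τ) • a + Real.sin (k * τ) • b)
          - (Real.cos (k * σ) • a + Real.sin (k * σ) • b)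
          - (τ - σ) • deriv (fun x : ℝ => Real.cos (k * x) • a + Real.sin (k * x) • b) σ)
      = (2 / q * liaSym (k * √q)) • cross t (Real.cos (k * τ) • a + Real.sin (k * τ) • b) := by
  -- linearity of the tree's `cross` in the second slot (inlined via the bundled `crossCLM`; the named forms live in
  -- unrelated Theorems files)
  have cross_add_right' : ∀ a b c : EuclideanSpace ℝ (Fin 3), cross a (b + c) = cross a b + cross a c :=
    fun a b c => by rw [← crossCLM_apply, map_add, crossCLM_apply, crossCLM_apply]
  have cross_smul_right' : ∀ (a b : EuclideanSpace ℝ (Fin 3)) (r : ℝ), cross a (r • b) = r • cross a b :=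
    fun a b r => by rw [← crossCLM_apply, map_smul, crossCLM_apply]
  -- the two scalar coefficient functions of the Taylor remainder, in the convolution variable
  set F₁ : ℝ → ℝ := fun s => ((s ^ 2 + q) ^ (3 / 2 : ℝ))⁻¹ *
      (Real.cos (k * τ) * (1 - Real.cos (k * s) - k * s * Real.sin (k * s))
        + (-Real.sin (k * τ)) * (Real.sin (k * s) - k * s * Real.cos (k * s))) with hF₁
  set F₂ : ℝ → ℝ := fun s => ((s ^ 2 + q) ^ (3 / 2 : ℝ))⁻¹ *
      (Real.sin (k * τ) * (1 - Real.cos (k * s) - k * s * Real.sin (k * s))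
        + Real.cos (k * τ) * (Real.sin (k * s) - k * s * Real.cos (k * s))) with hF₂
  -- pointwise: the vector integrand is `F₁(τ−σ) • t×a + F₂(τ−σ) • t×b`
  have hpt : ∀ σ : ℝ, (((τ - σ) ^ 2 + q) ^ (3 / 2 : ℝ))⁻¹ •
        cross t ((Real.cos (k * τ) • a + Real.sin (k * τ) • b)
          - (Real.cos (k * σ) • a + Real.sin (k * σ) • b)
          - (τ - σ) • deriv (fun x : ℝ => Real.cos (k * x) • a + Real.sin (k * x) • b) σ)
      = F₁ (τ - σ) • cross t a + F₂ (τ - σ) • cross t b := by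
    intro σ
    have hrem : (Real.cos (k * τ) • a + Real.sin (k * τ) • b)
          - (Real.cos (k * σ) • a + Real.sin (k * σ) • b)
          - (τ - σ) • ((-Real.sin (k * σ) * k) • a + (Real.cos (k * σ) * k) • b)
        = (Real.cos (k * τ) - Real.cos (k * σ) - (τ - σ) * (-k * Real.sin (k * σ))) • a
          + (Real.sin (k * τ) - Real.sin (k * σ) - (τ - σ) * (k * Real.cos (k * σ))) • b := by
      module
    rw [deriv_mode, hrem, cos_taylorRemainder, sin_taylorRemainder, cross_add_right', cross_smul_right',
      cross_smul_right', smul_add, smul_smul, smul_smul]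
    simp only [hF₁, hF₂]
    congr 1
    congr 1
    ring
  simp_rw [hpt]
  -- shift `σ ↦ τ − σ`, split, and evaluate the scalar integrals
  have hshift := integral_sub_left_eq_self (fun s : ℝ => F₁ s • cross t a + F₂ s • cross t b) volume τ
  rw [hshift]
  have hint : ∀ A B : ℝ, Integrable (fun s : ℝ => ((s ^ 2 + q) ^ (3 / 2 : ℝ))⁻¹ *
      (A * (1 - Real.cos (k * s) - k * s * Real.sin (k * s)) + B * (Real.sin (k * s) - k * s * Real.cos (k * s)))) := by
    intro A B
    have := ((integrable_liaFactor_mul_K3 hq k).const_mul A).add ((integrable_oddFactor_mul_K3 hq k).const_mul B)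
    refine this.congr (Filter.Eventually.of_forall fun s => ?_)
    simp only [Pi.add_apply]; ring
  have hI₁ : ∫ s, F₁ s = Real.cos (k * τ) * (2 / q * liaSym (k * √q)) :=
    integral_combination hq k (Real.cos (k * τ)) (-Real.sin (k * τ))
  have hI₂ : ∫ s, F₂ s = Real.sin (k * τ) * (2 / q * liaSym (k * √q)) :=
    integral_combination hq k (Real.sin (k * τ)) (Real.cos (k * τ))
  rw [integral_add ((hint _ _).smul_const _) ((hint _ _).smul_const _), integral_smul_const, integral_smul_const,
    hI₁, hI₂, cross_add_right', cross_smul_right', cross_smul_right', smul_add, smul_smul, smul_smul]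
  congr 1 <;> (congr 1; ring)

end Summit.NavierStokesRegularity.NavierStokesRegularity.Theorems.MatchedKernel
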